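/-
Copyright (c) 2026 the pub-hodgecm-mathlib formalisation cell (harness21).  Prover seat hodgecm-mathlib-LH5-p02 (g3): line LH3 (closer stub `stub_N9`), LETTER L1
`HcOrbitalFamiliesStatement`, clause (I₂), engine E3 «Harish-Chandra's parabolic unfolding on `U(2,1)_w`», brick (e3-4) (LH3-plan (g3) deal 2026-09-02T09:40:29Z).
-/
import Literature.NumberTheory.Automorphic.ArchU21SplitOrbitNormalised         -- ★ (e3-4a) (F0P3b-p01 (g16)): `normaliser_smul_integral_descConj_boostEig_eq_smul_integral_prod`, `exists_torusU_boostEig_family`; brings ★ (e3-3), ★ `boostEig` atlas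
import Literature.NumberTheory.Automorphic.ArchLocalTorusOrbitalBlockSmooth     -- ★ Hörmander engine `Literature.Analysis.Calculus.contDiffAt_integral_comp_of_contDiff_of_support`
import Literature.NumberTheory.Automorphic.UnitaryGroupContinuousOfMatrix      -- ★ `continuous_of_coe` (continuity into `U(σ, J)` is continuity of the matrix)
import HarnessLib

/-!
# (e3-4) `'F_f ∈ C^∞(T_s)` for the split Cartan of `U(2,1)`: the UNFOLDED integral `∫_{K × N} F_X(k · (u(X) n v(X)) · k⁻¹)` is `C^∞` in every smooth parameter `X`
# (Hörmander on the `K × N` side; any `U(J)(ℂ)`, compact `K`, closed `N′`), the `a`-substitution on the Heisenberg `N`, and the normalised orbital integral `= C •` it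

Topic `NumberTheory/Automorphic`; namespace `Literature.NumberTheory.Automorphic.UnitaryGroup`.  THEOREMS ONLY (no `def`, no instance, no notation, no axiom, no named fact,
no `sorry`); kernel lane `--kind proof --supports stmt-HodgeConjecture-24833`.  Cell `pub/hodgecm-mathlib`, crux H413 (`stmt-HodgeConjecture-24833`), F0∕P3c line LH3 (closer
stub `stub_N9`, N9″ DIRECT ROAD), LETTER L1 `HcOrbitalFamiliesStatement`, clause (I₂) «`orbFamGExt ν′ a′ S′` is `C^∞` on `InRegG s S′`», stratum (G3) SCALAR SPLIT POINTS of the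
census `F0/P3/F0P3b-p01/g16/CENSUS-I2-corners.v1.md` §3.2, engine E3, brick **(e3-4)** IN BINDER FORM (LH3-plan (g3) LETTER-L1 (I₂) BOARD; (e3-1)'s structural facts — the
compact `K∞`, the torus movers, the Iwasawa form `hμC` of the invariant measure — enter as BINDERS, exactly as in ★ (e3-3) `ArchU21SplitOrbitDescent`).

THE MATHEMATICS.  ★ (e3-4a) `ArchU21SplitOrbitNormalised` (F0P3b-p01 (g16)) proves, for `x ≠ 0` and the torus family `τ c = diag(boostEig c)` of `G = U(Φ₃)(ℂ) ≅ U(2,1)`, the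
NORMALISED IDENTITY `Δ(c) • ∫_{G ⧸ T} F(y · τ c · y⁻¹) dμ = C • ∫_{K × N} F(k · (m a_{x∕2} n a_{x∕2}) · k⁻¹) d(κ ⊗ μ_N)`, `Δ(c) = |eˣ − e⁻ˣ|·|e^{x+iθ} − e^{iφ}|·|e^{−x+iθ} − e^{iφ}| =
|D_G|^{1∕2}`, `m = τ(0, φ, θ)`, `a_{x∕2} = τ(x∕2, 0, 0)`.  This file is (e3-4b): the right side, the UNFOLDED integral `X = (z, c) ↦ ∫_{K × N} F_z(k · (u(X) · n · v(X)) · k⁻¹)`,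
`u = m·a_{x∕2}`, `v = a_{x∕2}`, has NO singularity at `x = 0` nor at the scalar points and is `C^∞` in `X` by ONE Hörmander call (§1): locally in `X` the integrand is supported in a FIXED compact subset of `K × N` (`K` compact, `N` closed) and is the smooth ambient function
`f(X, A · U(X) · B · V(X) · C)` of the continuous datum `(A, B, C) = (↑↑k, ↑↑n, ↑↑k⁻¹)`.  This is Harish-Chandra's `'F_f ∈ C^∞(T_s)` for the Cartan of `U(2,1)` with no imaginary
roots [Varadarajan1977 I §1.12], in the tree's currency; the rank-one twin is ★ `contDiff_integral_prod_conj_hypBlockGL_half_param` (p850603), which §1 generalises verbatim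
(`M₂ ↦ M_ι`, the movers `hyp(0,θ)hyp(x∕2,0)`, `hyp(x∕2,0)` abstracted to binders `u`, `v` smooth in matrix currency).
* §1 **`contDiff_integral_prod_conj_movers_param`** — GENERIC UNFOLDED-SIDE ENGINE: `U(J)(ℂ) ≤ GL_ι(ℂ)` any form, `K` compact, `N′` closed, `κ`, `μ` Haar, movers `u v : V → U(J)`
  continuous and smooth in matrix currency, `F_X = f(X, ↑↑·)` with `f` smooth and ONE compact support `S₀`: `X ↦ ∫_{K × N′} F_X(k (u X · n · v X) k⁻¹) d(κ ⊗ μ)` is `C^∞` on `V`;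
  **`contDiff_integral_prod_conj_movers`** (one test function `F = f ∘ ↑↑`, compactly supported).
* §2 `contDiff_boostEig_apply`, **`contDiff_diagonal_boostEig`** — the torus family `c ↦ diag(boostEig c) = diag(e^{x+iθ}, e^{iφ}, e^{−x+iθ})` is `C^∞` in matrix currency.
* §3 **`exists_contDiff_normaliser_smul_integral_descConj_boostEig_eq_param`** (HEAD, binder form over ★ (e3-4a)'s torus family `τ` = the four clauses of ★
  `exists_torusU_boostEig_family`): `∃ G ∈ C^∞(Z × ℝ³)` with `Δ(c) • ∫_{G ⧸ T} F_z(y · τ c · y⁻¹) dμ = G (z, c)` for `x = c 0 ≠ 0` (★ (e3-4a)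
  `normaliser_smul_integral_descConj_boostEig_eq_smul_integral_prod`), `G = C •` the unfolded integral (§1), and ON the wall `G (z, c) = C • ∫_{K×N} F_z(k (τ c · n) k⁻¹)`;
  **`contDiffOn_normaliser_smul_integral_descConj_boostEig_param`** (`C^∞` on `{x ≠ 0}`).  `'F_f ∈ C^∞(T_s)` THROUGH `x = 0` and the scalar points, jointly in `z`.
HONEST LABEL: HC_CM is proved only modulo the 7 printed citations (2 remaining named inputs: hLiu418 = `stmt-HodgeConjecture-24832`, h413 = `stmt-HodgeConjecture-24833`) until
rung 0 closes; measure theory over Mathlib + ★ kit, count-neutral (a letter-L1 (I₂) engine brick; pays nothing by itself).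

## References
* [Varadarajan1977] V. S. Varadarajan, *Harmonic Analysis on Real Reductive Groups*, LNM 576 (1977), Part I §1.12 (`'F_f` on a Cartan subgroup without singular imaginary roots).
* [Rogawski1990] J. D. Rogawski, *Automorphic Representations of Unitary Groups in Three Variables*, Ann. of Math. Stud. 123 (1990), §4.9 (4.9.1)–(4.9.2) p. 55, §4.13 p. 70, §8.2.
* [HormanderALPDO1] L. Hörmander, *The Analysis of Linear Partial Differential Operators I*, 2nd ed. (1990), §1.1 Thm. 1.1.9.
* [GetzHahn2024] J. R. Getz, H. Hahn, *An Introduction to Automorphic Representations*, GTM 300 (2024), §3.5 (3.10) (modules of automorphisms of `N`).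
* [Knapp1986] A. W. Knapp, *Representation Theory of Semisimple Groups* (1986), Ch. XI §7 (`F_f` on noncompact Cartans).
-/

set_option autoImplicit false

noncomputable section

open MeasureTheory MeasureTheory.Measure Set Filter Topology Complex
open Literature.MeasureTheory.Group
open scoped MatrixGroups ContDiff NNReal ENNReal
open scoped Matrix.Norms.Operator

namespace Literature.NumberTheory.Automorphic

namespace UnitaryGroup

open Literature.NumberTheory.Automorphic.UnitaryGroup.HeisRing Literature.NumberTheory.Automorphic.UnitaryGroup.LineRing

/-! ## §1 The generic unfolded-side engine: `X ↦ ∫_{K × N′} F_X(k (u X · n · v X) k⁻¹)` is `C^∞` -/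

section Movers

variable {ι : Type*} [Fintype ι] [DecidableEq ι] {J : Matrix ι ι ℂ}
  [MeasurableSpace ↥(unitaryGroupOfForm (starRingEnd ℂ) J)] [BorelSpace ↥(unitaryGroupOfForm (starRingEnd ℂ) J)]
  {K N' : Subgroup ↥(unitaryGroupOfForm (starRingEnd ℂ) J)} (κ : Measure ↥K) (μ : Measure ↥N')
  {E : Type*} [NormedAddCommGroup E] [NormedSpace ℝ E] [CompleteSpace E]
  {V : Type*} [NormedAddCommGroup V] [NormedSpace ℝ V] [FiniteDimensional ℝ V]

/-- **(e3-4) GENERIC UNFOLDED-SIDE ENGINE — JOINT `C^∞` OF `∫_{K × N′} F_X(k · (u(X) n v(X)) · k⁻¹)` IN THE PARAMETER `X`.**  `U(J)(ℂ) ≤ GL_ι(ℂ)` (any form `J`), `K ≤ U(J)(ℂ)`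
COMPACT, `N′ ≤ U(J)(ℂ)` CLOSED, `κ`, `μ` Haar measures on them; `V` a finite-dimensional real parameter space carrying two MOVERS `u v : V → U(J)(ℂ)`, continuous and `C^∞` in
matrix currency, and a family of test functions `F : V → U(J)(ℂ) → E` read through a smooth ambient `f : V × M_ι(ℂ) → E` (`F X g = f (X, ↑↑g)`) with all `F_X` supported in ONE
compact `S₀`.  Then **`X ↦ ∫_{K × N′} F_X(k · (u X · n · v X) · k⁻¹) d(κ ⊗ μ)` is `C^∞` on `V`**: locally in `X` the integrand is supported in a FIXED compact subset of `K × N′`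
(the `n` with `u X · n · v X ∈ k⁻¹ S₀ k` for some `k ∈ K`, `X` in a compact neighbourhood) and it is the smooth `Ψ((A, B, C), X) = f(X, A · ↑↑(u X) · B · ↑↑(v X) · C)` read at the
continuous datum `(↑↑k, ↑↑n, ↑↑k⁻¹)`, so the Hörmander engine ★ `contDiffAt_integral_comp_of_contDiff_of_support` applies.  (Rank one: ★ p850603 with `u = hyp(0,θ)hyp(x∕2,0)`,
`v = hyp(x∕2,0)`; `U(2,1)`: `u = m(θ,φ)·a_{x∕2}`, `v = a_{x∕2}`, `N′ =` the Heisenberg `N`, `K = K∞`.) [cite: Varadarajan1977, I §1.12] [cite: HormanderALPDO1, Thm. 1.1.9]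
[cite: Rogawski1990, §4.13 p. 70] -/
theorem contDiff_integral_prod_conj_movers_param (hK : IsCompact (K : Set ↥(unitaryGroupOfForm (starRingEnd ℂ) J)))
    (hN' : IsClosed (N' : Set ↥(unitaryGroupOfForm (starRingEnd ℂ) J)))
    [IsHaarMeasure κ] [IsHaarMeasure μ] (u v : V → ↥(unitaryGroupOfForm (starRingEnd ℂ) J)) (huc : Continuous u) (hvc : Continuous v)
    (hu : ContDiff ℝ ∞ fun X : V => (((u X : ↥(unitaryGroupOfForm (starRingEnd ℂ) J)) : GL ι ℂ) : Matrix ι ι ℂ))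
    (hv : ContDiff ℝ ∞ fun X : V => (((v X : ↥(unitaryGroupOfForm (starRingEnd ℂ) J)) : GL ι ℂ) : Matrix ι ι ℂ))
    (F : V → ↥(unitaryGroupOfForm (starRingEnd ℂ) J) → E)
    (f : V × Matrix ι ι ℂ → E) (hf : ContDiff ℝ ∞ f) (hFf : ∀ X g, F X g = f (X, ((g : GL ι ℂ) : Matrix ι ι ℂ)))
    {S₀ : Set ↥(unitaryGroupOfForm (starRingEnd ℂ) J)} (hS₀ : IsCompact S₀) (hFS : ∀ X g, g ∉ S₀ → F X g = 0) :
    ContDiff ℝ ∞ fun X : V => ∫ p : ↥K × ↥N',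
        F X ((p.1 : ↥(unitaryGroupOfForm (starRingEnd ℂ) J)) * (u X * (p.2 : ↥(unitaryGroupOfForm (starRingEnd ℂ) J)) * v X) *
          (p.1 : ↥(unitaryGroupOfForm (starRingEnd ℂ) J))⁻¹) ∂(κ.prod μ) := by
  haveI : LocallyCompactSpace ↥(unitaryGroupOfForm (starRingEnd ℂ) J) := locallyCompactSpace_unitaryGroupOfForm_complex J
  haveI : SecondCountableTopology ↥(unitaryGroupOfForm (starRingEnd ℂ) J) := secondCountableTopology_unitaryGroupOfForm_complex J
  haveI : LocallyCompactSpace ↥N' := hN'.isClosedEmbedding_subtypeVal.locallyCompactSpace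
  haveI : SecondCountableTopology ↥N' := TopologicalSpace.Subtype.secondCountableTopology _
  haveI : SecondCountableTopology ↥K := TopologicalSpace.Subtype.secondCountableTopology _
  haveI : BorelSpace ↥N' := Subtype.borelSpace _
  haveI : BorelSpace ↥K := Subtype.borelSpace _
  haveI : BorelSpace (↥K × ↥N') := Prod.borelSpace
  haveI : CompactSpace ↥K := isCompact_iff_compactSpace.1 hK
  haveI : LocallyCompactSpace ↥K := hK.isClosed.isClosedEmbedding_subtypeVal.locallyCompactSpace
  -- the integrand as a function of `(X, p)`
  obtain ⟨g, hg⟩ : ∃ g : V → ↥K × ↥N' → E, g = fun X p =>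
      F X ((p.1 : ↥(unitaryGroupOfForm (starRingEnd ℂ) J)) * (u X * (p.2 : ↥(unitaryGroupOfForm (starRingEnd ℂ) J)) * v X) *
        (p.1 : ↥(unitaryGroupOfForm (starRingEnd ℂ) J))⁻¹) := ⟨_, rfl⟩
  have hgoal : (fun X : V => ∫ p : ↥K × ↥N',
        F X ((p.1 : ↥(unitaryGroupOfForm (starRingEnd ℂ) J)) * (u X * (p.2 : ↥(unitaryGroupOfForm (starRingEnd ℂ) J)) * v X) *
          (p.1 : ↥(unitaryGroupOfForm (starRingEnd ℂ) J))⁻¹) ∂(κ.prod μ)) = fun X => ∫ p, g X p ∂(κ.prod μ) := by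
    rw [hg]
  rw [hgoal]
  -- the smooth factorisation `g X (k, n) = Ψ ((↑↑k, ↑↑n, ↑↑k⁻¹), X)`
  let P3 := Matrix ι ι ℂ × Matrix ι ι ℂ × Matrix ι ι ℂ
  obtain ⟨Ψ, hΨ⟩ : ∃ Ψ : P3 × V → E, Ψ = fun w =>
      f (w.2, w.1.1 * ((((u w.2 : ↥(unitaryGroupOfForm (starRingEnd ℂ) J)) : GL ι ℂ) : Matrix ι ι ℂ) * w.1.2.1 *
        (((v w.2 : ↥(unitaryGroupOfForm (starRingEnd ℂ) J)) : GL ι ℂ) : Matrix ι ι ℂ)) * w.1.2.2) := ⟨_, rfl⟩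
  have hΨs : ContDiff ℝ ∞ Ψ := by
    rw [hΨ]
    refine hf.comp (contDiff_snd.prodMk ?_)
    have hA : ContDiff ℝ ∞ fun w : P3 × V => w.1.1 := contDiff_fst.comp contDiff_fst
    have hB : ContDiff ℝ ∞ fun w : P3 × V => w.1.2.1 := contDiff_fst.comp (contDiff_snd.comp contDiff_fst)
    have hC : ContDiff ℝ ∞ fun w : P3 × V => w.1.2.2 := contDiff_snd.comp (contDiff_snd.comp contDiff_fst)
    have hu' := hu.comp (contDiff_snd (E := P3) (F := V))
    have hv' := hv.comp (contDiff_snd (E := P3) (F := V))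
    exact (hA.mul ((hu'.mul hB).mul hv')).mul hC
  obtain ⟨y, hy⟩ : ∃ y : ↥K × ↥N' → P3, y = fun p =>
      ((((p.1 : ↥(unitaryGroupOfForm (starRingEnd ℂ) J)) : GL ι ℂ) : Matrix ι ι ℂ),
        ((((p.2 : ↥(unitaryGroupOfForm (starRingEnd ℂ) J)) : GL ι ℂ) : Matrix ι ι ℂ),
          ((((p.1 : ↥(unitaryGroupOfForm (starRingEnd ℂ) J))⁻¹ : ↥(unitaryGroupOfForm (starRingEnd ℂ) J)) : GL ι ℂ) : Matrix ι ι ℂ))) := ⟨_, rfl⟩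
  have hcoe : Continuous fun w : ↥(unitaryGroupOfForm (starRingEnd ℂ) J) => ((w : GL ι ℂ) : Matrix ι ι ℂ) :=
    Units.continuous_val.comp continuous_subtype_val
  have hyc : Continuous y := by
    rw [hy]
    exact (hcoe.comp (continuous_subtype_val.comp continuous_fst)).prodMk
      ((hcoe.comp (continuous_subtype_val.comp continuous_snd)).prodMk (hcoe.comp ((continuous_subtype_val.comp continuous_fst).inv)))
  have hfac : ∀ X p, g X p = Ψ (y p, X) := by
    intro X p
    rw [hg, hΨ, hy]
    simp only [hFf, Subgroup.coe_mul, Units.val_mul]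
  have hgoal' : (fun X => ∫ p, g X p ∂(κ.prod μ)) = fun X => ∫ p, Ψ (y p, X) ∂(κ.prod μ) := by
    funext X
    exact integral_congr_ae (Filter.Eventually.of_forall fun p => hfac X p)
  rw [hgoal']
  refine contDiff_iff_contDiffAt.2 fun X₀ => ?_
  -- a compact neighbourhood of `X₀` and a compact set of `K × N′` carrying the support there
  obtain ⟨W, hWc, hWn⟩ := exists_compact_mem_nhds X₀
  obtain ⟨Φ, hΦ⟩ : ∃ Φ : V × ↥K × ↥(unitaryGroupOfForm (starRingEnd ℂ) J) → ↥(unitaryGroupOfForm (starRingEnd ℂ) J),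
      Φ = fun q => (u q.1)⁻¹ * (((q.2.1 : ↥K) : ↥(unitaryGroupOfForm (starRingEnd ℂ) J))⁻¹ * q.2.2 *
        ((q.2.1 : ↥K) : ↥(unitaryGroupOfForm (starRingEnd ℂ) J))) * (v q.1)⁻¹ := ⟨_, rfl⟩
  have hΦc : Continuous Φ := by
    rw [hΦ]
    have h1 : Continuous fun q : V × ↥K × ↥(unitaryGroupOfForm (starRingEnd ℂ) J) =>
        ((q.2.1 : ↥K) : ↥(unitaryGroupOfForm (starRingEnd ℂ) J)) := continuous_subtype_val.comp (continuous_fst.comp continuous_snd)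
    have h3 : Continuous fun q : V × ↥K × ↥(unitaryGroupOfForm (starRingEnd ℂ) J) => v q.1 := hvc.comp continuous_fst
    have h4 : Continuous fun q : V × ↥K × ↥(unitaryGroupOfForm (starRingEnd ℂ) J) => u q.1 := huc.comp continuous_fst
    exact (h4.inv.mul ((h1.inv.mul (continuous_snd.comp continuous_snd)).mul h1)).mul h3.inv
  set S₁ : Set ↥(unitaryGroupOfForm (starRingEnd ℂ) J) := Φ '' (W ×ˢ (univ ×ˢ S₀)) with hS₁
  have hS₁c : IsCompact S₁ := ((hWc.prod (isCompact_univ.prod hS₀)).image hΦc)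
  set N₀ : Set ↥N' := Subtype.val ⁻¹' S₁ with hN₀
  have hN₀c : IsCompact N₀ := hN'.isClosedEmbedding_subtypeVal.isCompact_preimage hS₁c
  set s : Set (↥K × ↥N') := univ ×ˢ N₀ with hs
  have hsc : IsCompact s := isCompact_univ.prod hN₀c
  -- off `s` the integrand vanishes, for `X ∈ W`
  have hzero : ∀ p, p ∉ s → ∀ X ∈ W, Ψ (y p, X) = 0 := by
    intro p hp X hX
    rw [← hfac, hg]
    by_contra hne
    apply hp
    refine mk_mem_prod (mem_univ _) ?_
    change ((p.2 : ↥N') : ↥(unitaryGroupOfForm (starRingEnd ℂ) J)) ∈ S₁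
    have hmem : (p.1 : ↥(unitaryGroupOfForm (starRingEnd ℂ) J)) * (u X * (p.2 : ↥(unitaryGroupOfForm (starRingEnd ℂ) J)) * v X) *
        (p.1 : ↥(unitaryGroupOfForm (starRingEnd ℂ) J))⁻¹ ∈ S₀ := by
      by_contra hout
      exact hne (hFS X _ hout)
    refine ⟨(X, p.1, (p.1 : ↥(unitaryGroupOfForm (starRingEnd ℂ) J)) * (u X * (p.2 : ↥(unitaryGroupOfForm (starRingEnd ℂ) J)) * v X) *
      (p.1 : ↥(unitaryGroupOfForm (starRingEnd ℂ) J))⁻¹), mk_mem_prod hX (mk_mem_prod (mem_univ _) hmem), ?_⟩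
    rw [hΦ]
    simp only
    group
  exact Literature.Analysis.Calculus.contDiffAt_integral_comp_of_contDiff_of_support (κ.prod μ) Ψ hΨs y hyc X₀ hsc hWn hzero

/-- **(e3-4) engine without parameter in the test function**: ONE test function `F = f ∘ ↑↑` (`f` smooth on `M_ι(ℂ)`, `F` compactly supported) and movers `u v : V → U(J)(ℂ)`:
`X ↦ ∫_{K × N′} F(k (u X · n · v X) k⁻¹) d(κ ⊗ μ)` is `C^∞` on `V`. [cite: Varadarajan1977, I §1.12] [cite: HormanderALPDO1, Thm. 1.1.9] -/
theorem contDiff_integral_prod_conj_movers (hK : IsCompact (K : Set ↥(unitaryGroupOfForm (starRingEnd ℂ) J)))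
    (hN' : IsClosed (N' : Set ↥(unitaryGroupOfForm (starRingEnd ℂ) J)))
    [IsHaarMeasure κ] [IsHaarMeasure μ] (u v : V → ↥(unitaryGroupOfForm (starRingEnd ℂ) J)) (huc : Continuous u) (hvc : Continuous v)
    (hu : ContDiff ℝ ∞ fun X : V => (((u X : ↥(unitaryGroupOfForm (starRingEnd ℂ) J)) : GL ι ℂ) : Matrix ι ι ℂ))
    (hv : ContDiff ℝ ∞ fun X : V => (((v X : ↥(unitaryGroupOfForm (starRingEnd ℂ) J)) : GL ι ℂ) : Matrix ι ι ℂ))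
    (F : ↥(unitaryGroupOfForm (starRingEnd ℂ) J) → E)
    (f : Matrix ι ι ℂ → E) (hf : ContDiff ℝ ∞ f) (hFf : ∀ g, F g = f ((g : GL ι ℂ) : Matrix ι ι ℂ)) (hFc : HasCompactSupport F) :
    ContDiff ℝ ∞ fun X : V => ∫ p : ↥K × ↥N',
        F ((p.1 : ↥(unitaryGroupOfForm (starRingEnd ℂ) J)) * (u X * (p.2 : ↥(unitaryGroupOfForm (starRingEnd ℂ) J)) * v X) *
          (p.1 : ↥(unitaryGroupOfForm (starRingEnd ℂ) J))⁻¹) ∂(κ.prod μ) :=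
  contDiff_integral_prod_conj_movers_param κ μ hK hN' u v huc hvc hu hv (fun _ => F) (fun w => f w.2) (hf.comp contDiff_snd)
    (fun _ g => hFf g) hFc.isCompact (fun _ _ hg => image_eq_zero_of_notMem_tsupport hg)

end Movers

/-! ## §2 The torus family `c ↦ diag(boostEig c)` is smooth in matrix currency -/

section BoostEig

/-- Each eigenvalue `boostEig c i ∈ {e^{x+iθ}, e^{iφ}, e^{−x+iθ}}` is `C^∞` in `c = (x, φ, θ) ∈ ℝ³` (exponential of a real-linear form). [cite: Knapp1986, Ch. V §3] -/
theorem contDiff_boostEig_apply (i : Fin 3) : ContDiff ℝ ∞ fun c : Fin 3 → ℝ => boostEig c i := by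
  have hl : ∀ j : Fin 3, ContDiff ℝ ∞ fun c : Fin 3 → ℝ => ((c j : ℝ) : ℂ) := fun j =>
    ofRealCLM.contDiff.comp (contDiff_apply ℝ ℝ j)
  fin_cases i
  · show ContDiff ℝ ∞ fun c : Fin 3 → ℝ => Complex.exp ((c 0 : ℂ) + (c 2 : ℂ) * I)
    exact Complex.contDiff_exp.comp ((hl 0).add ((hl 2).mul contDiff_const))
  · show ContDiff ℝ ∞ fun c : Fin 3 → ℝ => Complex.exp ((c 1 : ℂ) * I)
    exact Complex.contDiff_exp.comp ((hl 1).mul contDiff_const)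
  · show ContDiff ℝ ∞ fun c : Fin 3 → ℝ => Complex.exp (-(c 0 : ℂ) + (c 2 : ℂ) * I)
    exact Complex.contDiff_exp.comp ((hl 0).neg.add ((hl 2).mul contDiff_const))

/-- **`c ↦ diag(boostEig c) ∈ M₃(ℂ)` is `C^∞`** (entries `boostEig c i` on the diagonal, `0` off it; through the linear `Matrix.of`). [cite: Knapp1986, Ch. V §3] -/
theorem contDiff_diagonal_boostEig : ContDiff ℝ ∞ fun c : Fin 3 → ℝ => Matrix.diagonal (boostEig c) := by
  let Λ : (Fin 3 → Fin 3 → ℂ) →L[ℝ] Matrix (Fin 3) (Fin 3) ℂ :=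
    LinearMap.toContinuousLinearMap (Matrix.ofLinearEquiv ℝ : (Fin 3 → Fin 3 → ℂ) ≃ₗ[ℝ] Matrix (Fin 3) (Fin 3) ℂ).toLinearMap
  have hΛ : ∀ g : Fin 3 → Fin 3 → ℂ, Λ g = Matrix.of g := fun _ => rfl
  have hfun : (fun c : Fin 3 → ℝ => Matrix.diagonal (boostEig c)) = fun c => Λ fun i j => Matrix.diagonal (boostEig c) i j := by
    funext c; rw [hΛ]; rfl
  rw [hfun]
  refine Λ.contDiff.comp (contDiff_pi.2 fun i => contDiff_pi.2 fun j => ?_)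
  by_cases hij : i = j
  · subst hij
    simp only [Matrix.diagonal_apply_eq]
    exact contDiff_boostEig_apply i
  · simp only [Matrix.diagonal_apply_ne _ hij]
    exact contDiff_const

end BoostEig

/-! ## §3 HEAD: the `|D_G|^{1∕2}`-normalised split-Cartan orbital integral of `U(Φ₃)(ℂ)` extends `C^∞` through `x = 0` and the scalar points, jointly in the parameter -/

section Head

variable {J : Matrix (Fin 3) (Fin 3) ℂ} (hJ : J = (StdForm.antidiagonal 3).over ℂ)
  [MeasurableSpace ↥(unitaryGroupOfForm (starRingEnd ℂ) J)] [BorelSpace ↥(unitaryGroupOfForm (starRingEnd ℂ) J)]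
  {K : Subgroup ↥(unitaryGroupOfForm (starRingEnd ℂ) J)} (κ : Measure ↥K)
  (μN : Measure ↥(unipotentU (starRingEnd ℂ) J)) {E : Type*} [NormedAddCommGroup E] [NormedSpace ℝ E] [CompleteSpace E]
  [MeasurableSpace (↥(unitaryGroupOfForm (starRingEnd ℂ) J) ⧸ torusU (starRingEnd ℂ) J)]
  [BorelSpace (↥(unitaryGroupOfForm (starRingEnd ℂ) J) ⧸ torusU (starRingEnd ℂ) J)]
  (μ : Measure (↥(unitaryGroupOfForm (starRingEnd ℂ) J) ⧸ torusU (starRingEnd ℂ) J))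
  {Z : Type*} [NormedAddCommGroup Z] [NormedSpace ℝ Z] [FiniteDimensional ℝ Z]

/-- `c ↦ (0, φ, θ)` is smooth on `ℝ³`. [folklore] -/
private theorem contDiff_mvec : ContDiff ℝ ∞ fun c : Fin 3 → ℝ => (![0, c 1, c 2] : Fin 3 → ℝ) := by
  refine contDiff_pi.2 fun i => ?_
  fin_cases i
  · exact contDiff_const
  · exact contDiff_apply ℝ ℝ 1
  · exact contDiff_apply ℝ ℝ 2

/-- `c ↦ (x∕2, 0, 0)` is smooth on `ℝ³`. [folklore] -/
private theorem contDiff_svec : ContDiff ℝ ∞ fun c : Fin 3 → ℝ => (![c 0 / 2, 0, 0] : Fin 3 → ℝ) := by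
  refine contDiff_pi.2 fun i => ?_
  fin_cases i
  · exact (contDiff_apply ℝ ℝ 0).div_const 2
  · exact contDiff_const
  · exact contDiff_const

/-- `c = (0, φ, θ) + (x∕2, 0, 0) + (x∕2, 0, 0)` in `ℝ³`. [folklore] -/
private theorem mvec_add_svec_add_svec (c : Fin 3 → ℝ) : (![0, c 1, c 2] : Fin 3 → ℝ) + ![c 0 / 2, 0, 0] + ![c 0 / 2, 0, 0] = c := by
  funext i
  fin_cases i
  · simp
  · simp
  · simp

include hJ in
/-- **(e3-4b) HEAD — `'F_f ∈ C^∞(T_s)` FOR THE SPLIT CARTAN OF `U(2,1)`, JOINTLY IN A SMOOTH PARAMETER OF THE TEST FUNCTION.**  `K ≤ U(Φ₃)(ℂ)` compact, `κ`, `μ_N` Haar,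
`μ = C • ((k, n) ↦ k n T)_*(κ ⊗ μ_N)` on `G ⧸ T` (binder `hμC`, brick (e3-1)); `τ : ℝ³ → T` the torus family `τ c = diag(boostEig c) = diag(e^{x+iθ}, e^{iφ}, e^{−x+iθ})`, a homomorphism
with diagonal unit data (binders `hτT hτcoe hτmul hτd` = the four clauses of ★ `exists_torusU_boostEig_family`, ONE `obtain`); test functions `F : Z → U(Φ₃)(ℂ) → E` read through a
smooth ambient `f : Z × M₃(ℂ) → E` with ONE compact support `S₀`.  Then there is **`G ∈ C^∞(Z × ℝ³)`** with, for every `z` and every `c = (x, φ, θ)` with `x ≠ 0`,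
**`(|eˣ − e⁻ˣ|·|e^{x+iθ} − e^{iφ}|·|e^{−x+iθ} − e^{iφ}|) • ∫_{G ⧸ T} F_z(y · τ c · y⁻¹) dμ(y) = G (z, c)`**, namely `G (z, c) = C • ∫_{K × N} F_z(k · (m a_{x∕2} n a_{x∕2}) · k⁻¹) d(κ ⊗ μ_N)`
(`m = τ(0, φ, θ)`, `a_{x∕2} = τ(x∕2, 0, 0)`; ★ (e3-4a) `normaliser_smul_integral_descConj_boostEig_eq_smul_integral_prod` off the wall, §1 for the smoothness), and ON the wall
`G (z, c) = C • ∫_{K × N} F_z(k · (τ c · n) · k⁻¹)` (`x = 0`: `a_0 = 1`, `m = τ c`).  So the `|D_G|^{1∕2}`-normalised split-Cartan orbital integral EXTENDS `C^∞` THROUGH the real wall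
`x = 0` AND the scalar points `x = 0 ∧ e^{iθ} = e^{iφ}`: Harish-Chandra's `'F_f ∈ C^∞(T_s)` for the Cartan of `U(2,1)` with no imaginary roots — the rank-2 twin of ★
`exists_contDiff_abs_sub_smul_integral_descConj_hypBlockGL_eq_param` (p850603). [cite: Varadarajan1977, I §1.12] [cite: Rogawski1990, §4.13 p. 70; §8.2]
[cite: HormanderALPDO1, Thm. 1.1.9] [cite: Knapp1986, Ch. XI §7] -/
theorem exists_contDiff_normaliser_smul_integral_descConj_boostEig_eq_param
    (hK : IsCompact (K : Set ↥(unitaryGroupOfForm (starRingEnd ℂ) J))) [IsHaarMeasure κ] [IsHaarMeasure μN] {C : ℝ≥0}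
    (hμC : μ = C • Measure.map
      (fun p : ↥K × ↥(unipotentU (starRingEnd ℂ) J) =>
        (QuotientGroup.mk ((p.1 : ↥(unitaryGroupOfForm (starRingEnd ℂ) J)) * (p.2 : ↥(unitaryGroupOfForm (starRingEnd ℂ) J))) :
          ↥(unitaryGroupOfForm (starRingEnd ℂ) J) ⧸ torusU (starRingEnd ℂ) J))
      (κ.prod μN))
    (τ : (Fin 3 → ℝ) → ↥(unitaryGroupOfForm (starRingEnd ℂ) J)) (hτT : ∀ c, τ c ∈ torusU (starRingEnd ℂ) J)
    (hτcoe : ∀ c, (((τ c : ↥(unitaryGroupOfForm (starRingEnd ℂ) J)) : GL (Fin 3) ℂ) : Matrix (Fin 3) (Fin 3) ℂ) = Matrix.diagonal (boostEig c))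
    (hτmul : ∀ c c', τ (c + c') = τ c * τ c')
    (hτd : ∀ c, ∃ d : Fin 3 → ℂˣ, glDiagonal 3 ℂ d = ((τ c : ↥(unitaryGroupOfForm (starRingEnd ℂ) J)) : GL (Fin 3) ℂ) ∧ ∀ i, (d i : ℂ) = boostEig c i)
    (F : Z → ↥(unitaryGroupOfForm (starRingEnd ℂ) J) → E)
    (f : Z × Matrix (Fin 3) (Fin 3) ℂ → E) (hf : ContDiff ℝ ∞ f) (hFf : ∀ z g, F z g = f (z, ((g : GL (Fin 3) ℂ) : Matrix (Fin 3) (Fin 3) ℂ)))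
    {S₀ : Set ↥(unitaryGroupOfForm (starRingEnd ℂ) J)} (hS₀ : IsCompact S₀) (hFS : ∀ z g, g ∉ S₀ → F z g = 0) :
    ∃ G : Z × (Fin 3 → ℝ) → E, ContDiff ℝ ∞ G ∧
      (∀ (z : Z) (c : Fin 3 → ℝ), c 0 ≠ 0 →
        (|Real.exp (c 0) - Real.exp (-c 0)| * ‖Complex.exp ((c 0 : ℂ) + (c 2 : ℂ) * I) - Complex.exp ((c 1 : ℂ) * I)‖ *
            ‖Complex.exp (-(c 0 : ℂ) + (c 2 : ℂ) * I) - Complex.exp ((c 1 : ℂ) * I)‖) •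
          ∫ y, descConj (τ c) (torusU (starRingEnd ℂ) J) (LineRing.forall_mem_torusU_comm (starRingEnd ℂ) J (hτT c)) (F z) y ∂μ = G (z, c)) ∧
      (∀ (z : Z) (c : Fin 3 → ℝ), G (z, c) = (C : ℝ) • ∫ p : ↥K × ↥(unipotentU (starRingEnd ℂ) J),
        F z ((p.1 : ↥(unitaryGroupOfForm (starRingEnd ℂ) J)) *
          (τ ![0, c 1, c 2] * τ ![c 0 / 2, 0, 0] * (p.2 : ↥(unitaryGroupOfForm (starRingEnd ℂ) J)) * τ ![c 0 / 2, 0, 0]) *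
          (p.1 : ↥(unitaryGroupOfForm (starRingEnd ℂ) J))⁻¹) ∂(κ.prod μN)) ∧
      ∀ (z : Z) (c : Fin 3 → ℝ), c 0 = 0 → G (z, c) = (C : ℝ) • ∫ p : ↥K × ↥(unipotentU (starRingEnd ℂ) J),
        F z ((p.1 : ↥(unitaryGroupOfForm (starRingEnd ℂ) J)) * (τ c * (p.2 : ↥(unitaryGroupOfForm (starRingEnd ℂ) J))) *
          (p.1 : ↥(unitaryGroupOfForm (starRingEnd ℂ) J))⁻¹) ∂(κ.prod μN) := by
  have hN : IsClosed (unipotentU (starRingEnd ℂ) J : Set ↥(unitaryGroupOfForm (starRingEnd ℂ) J)) := isClosed_unipotentU _ _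
  have hJJ : J * J = 1 := by rw [hJ]; exact StdForm.over_mul_over _ _
  -- `τ 0 = 1`
  have hτ0 : τ 0 = 1 := by
    have h : τ 0 * τ 0 = τ 0 * 1 := by rw [mul_one, ← hτmul, add_zero]
    exact mul_left_cancel h
  -- smoothness ∕ continuity of `X ↦ τ (g X)` for smooth `g`
  have hsm : ∀ g : Z × (Fin 3 → ℝ) → (Fin 3 → ℝ), ContDiff ℝ ∞ g →
      ContDiff ℝ ∞ fun X => (((τ (g X) : ↥(unitaryGroupOfForm (starRingEnd ℂ) J)) : GL (Fin 3) ℂ) : Matrix (Fin 3) (Fin 3) ℂ) := fun g hg => by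
    have e : (fun X => (((τ (g X) : ↥(unitaryGroupOfForm (starRingEnd ℂ) J)) : GL (Fin 3) ℂ) : Matrix (Fin 3) (Fin 3) ℂ)) =
        fun X => Matrix.diagonal (boostEig (g X)) := funext fun X => hτcoe (g X)
    rw [e]
    exact contDiff_diagonal_boostEig.comp hg
  have hct : ∀ g : Z × (Fin 3 → ℝ) → (Fin 3 → ℝ), ContDiff ℝ ∞ g → Continuous fun X => τ (g X) := fun g hg =>
    continuous_of_coe Complex.continuous_conj hJJ (hsm g hg).continuous
  have hgm : ContDiff ℝ ∞ fun X : Z × (Fin 3 → ℝ) => (![0, X.2 1, X.2 2] : Fin 3 → ℝ) := contDiff_mvec.comp contDiff_snd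
  have hgs : ContDiff ℝ ∞ fun X : Z × (Fin 3 → ℝ) => (![X.2 0 / 2, 0, 0] : Fin 3 → ℝ) := contDiff_svec.comp contDiff_snd
  have hu : ContDiff ℝ ∞ fun X : Z × (Fin 3 → ℝ) =>
      (((τ ![0, X.2 1, X.2 2] * τ ![X.2 0 / 2, 0, 0] : ↥(unitaryGroupOfForm (starRingEnd ℂ) J)) : GL (Fin 3) ℂ) : Matrix (Fin 3) (Fin 3) ℂ) := by
    have e : (fun X : Z × (Fin 3 → ℝ) => (((τ ![0, X.2 1, X.2 2] * τ ![X.2 0 / 2, 0, 0] : ↥(unitaryGroupOfForm (starRingEnd ℂ) J)) : GL (Fin 3) ℂ) : Matrix (Fin 3) (Fin 3) ℂ)) =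
        fun X => (((τ ![0, X.2 1, X.2 2] : ↥(unitaryGroupOfForm (starRingEnd ℂ) J)) : GL (Fin 3) ℂ) : Matrix (Fin 3) (Fin 3) ℂ) *
          (((τ ![X.2 0 / 2, 0, 0] : ↥(unitaryGroupOfForm (starRingEnd ℂ) J)) : GL (Fin 3) ℂ) : Matrix (Fin 3) (Fin 3) ℂ) :=
      funext fun X => by rw [Subgroup.coe_mul, Units.val_mul]
    rw [e]
    exact (hsm _ hgm).mul (hsm _ hgs)
  have hsmooth := contDiff_integral_prod_conj_movers_param κ μN hK hN
    (fun X : Z × (Fin 3 → ℝ) => τ ![0, X.2 1, X.2 2] * τ ![X.2 0 / 2, 0, 0]) (fun X : Z × (Fin 3 → ℝ) => τ ![X.2 0 / 2, 0, 0])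
    ((hct _ hgm).mul (hct _ hgs)) (hct _ hgs) hu (hsm _ hgs) (fun X => F X.1) (fun w => f (w.1.1, w.2))
    (hf.comp ((contDiff_fst.comp contDiff_fst).prodMk contDiff_snd)) (fun X g => hFf X.1 g) hS₀ (fun X g hg => hFS X.1 g hg)
  refine ⟨fun X => (C : ℝ) • ∫ p : ↥K × ↥(unipotentU (starRingEnd ℂ) J),
      F X.1 ((p.1 : ↥(unitaryGroupOfForm (starRingEnd ℂ) J)) *
        (τ ![0, X.2 1, X.2 2] * τ ![X.2 0 / 2, 0, 0] * (p.2 : ↥(unitaryGroupOfForm (starRingEnd ℂ) J)) * τ ![X.2 0 / 2, 0, 0]) *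
        (p.1 : ↥(unitaryGroupOfForm (starRingEnd ℂ) J))⁻¹) ∂(κ.prod μN),
    hsmooth.const_smul (C : ℝ), fun z c hx => ?_, fun z c => rfl, fun z c hc0 => ?_⟩
  · -- off the wall: ★ (e3-4a)
    obtain ⟨dt, hdt, hdtc⟩ := hτd c
    obtain ⟨ds, hds, hdsc⟩ := hτd ![c 0 / 2, 0, 0]
    have htms : τ c = τ ![0, c 1, c 2] * τ ![c 0 / 2, 0, 0] * τ ![c 0 / 2, 0, 0] := by
      conv_lhs => rw [← mvec_add_svec_add_svec c]
      rw [hτmul, hτmul]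
    have hFz : Continuous (F z) := by
      have e : F z = fun g : ↥(unitaryGroupOfForm (starRingEnd ℂ) J) => f (z, ((g : GL (Fin 3) ℂ) : Matrix (Fin 3) (Fin 3) ℂ)) := funext fun g => hFf z g
      rw [e]
      exact hf.continuous.comp (continuous_const.prodMk (Units.continuous_val.comp continuous_subtype_val))
    haveI : CompactSpace ↥K := isCompact_iff_compactSpace.1 hK
    exact normaliser_smul_integral_descConj_boostEig_eq_smul_integral_prod hJ κ μN μ hμC (hτT c) (hτT _) htms c hx hdt hdtc hds hdsc (F z) hFz
  · -- on the wall: `a_0 = 1`, `m = τ c`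
    have h0 : (![c 0 / 2, 0, 0] : Fin 3 → ℝ) = 0 := by
      funext i
      fin_cases i
      · simp [hc0]
      · simp
      · simp
    have hm : (![0, c 1, c 2] : Fin 3 → ℝ) = c := by
      funext i
      fin_cases i
      · simp [hc0]
      · simp
      · simp
    simp only [h0, hm, hτ0, mul_one]

include hJ in
/-- **Off the real wall the normalised split-Cartan orbital integral IS `C^∞`** (jointly in the parameter): `ContDiffOn ℝ ∞` on `{(z, c) | c 0 ≠ 0}` — the restriction of the smooth `G` of
`exists_contDiff_normaliser_smul_integral_descConj_boostEig_eq_param`. [cite: Varadarajan1977, I §1.12] [cite: Rogawski1990, §8.2] -/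
theorem contDiffOn_normaliser_smul_integral_descConj_boostEig_param
    (hK : IsCompact (K : Set ↥(unitaryGroupOfForm (starRingEnd ℂ) J))) [IsHaarMeasure κ] [IsHaarMeasure μN] {C : ℝ≥0}
    (hμC : μ = C • Measure.map
      (fun p : ↥K × ↥(unipotentU (starRingEnd ℂ) J) =>
        (QuotientGroup.mk ((p.1 : ↥(unitaryGroupOfForm (starRingEnd ℂ) J)) * (p.2 : ↥(unitaryGroupOfForm (starRingEnd ℂ) J))) :
          ↥(unitaryGroupOfForm (starRingEnd ℂ) J) ⧸ torusU (starRingEnd ℂ) J))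
      (κ.prod μN))
    (τ : (Fin 3 → ℝ) → ↥(unitaryGroupOfForm (starRingEnd ℂ) J)) (hτT : ∀ c, τ c ∈ torusU (starRingEnd ℂ) J)
    (hτcoe : ∀ c, (((τ c : ↥(unitaryGroupOfForm (starRingEnd ℂ) J)) : GL (Fin 3) ℂ) : Matrix (Fin 3) (Fin 3) ℂ) = Matrix.diagonal (boostEig c))
    (hτmul : ∀ c c', τ (c + c') = τ c * τ c')
    (hτd : ∀ c, ∃ d : Fin 3 → ℂˣ, glDiagonal 3 ℂ d = ((τ c : ↥(unitaryGroupOfForm (starRingEnd ℂ) J)) : GL (Fin 3) ℂ) ∧ ∀ i, (d i : ℂ) = boostEig c i)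
    (F : Z → ↥(unitaryGroupOfForm (starRingEnd ℂ) J) → E)
    (f : Z × Matrix (Fin 3) (Fin 3) ℂ → E) (hf : ContDiff ℝ ∞ f) (hFf : ∀ z g, F z g = f (z, ((g : GL (Fin 3) ℂ) : Matrix (Fin 3) (Fin 3) ℂ)))
    {S₀ : Set ↥(unitaryGroupOfForm (starRingEnd ℂ) J)} (hS₀ : IsCompact S₀) (hFS : ∀ z g, g ∉ S₀ → F z g = 0) :
    ContDiffOn ℝ ∞ (fun X : Z × (Fin 3 → ℝ) =>
        (|Real.exp (X.2 0) - Real.exp (-X.2 0)| * ‖Complex.exp ((X.2 0 : ℂ) + (X.2 2 : ℂ) * I) - Complex.exp ((X.2 1 : ℂ) * I)‖ *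
            ‖Complex.exp (-(X.2 0 : ℂ) + (X.2 2 : ℂ) * I) - Complex.exp ((X.2 1 : ℂ) * I)‖) •
          ∫ y, descConj (τ X.2) (torusU (starRingEnd ℂ) J) (LineRing.forall_mem_torusU_comm (starRingEnd ℂ) J (hτT X.2)) (F X.1) y ∂μ)
      {X : Z × (Fin 3 → ℝ) | X.2 0 ≠ 0} := by
  obtain ⟨G, hG, hGeq, -, -⟩ := exists_contDiff_normaliser_smul_integral_descConj_boostEig_eq_param hJ κ μN μ hK hμC τ hτT hτcoe hτmul hτd F f hf hFf hS₀ hFS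
  exact hG.contDiffOn.congr fun X hX => hGeq X.1 X.2 hX

end Head

end UnitaryGroup

end Literature.NumberTheory.Automorphic

end
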